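import Summits.BirchSwinnertonDyer.BirchSwinnertonDyer.Theorems.AlignedTransportAtTwoMainConjectureOfRankZeroBSDAtTwoPointFieldCarrierDSixExact
import HarnessLib

/-!
# Route `AlignedTransportAtTwo`, crux C2 `MainConjectureOfRankZeroBSDAtTwo` (stmt-BirchSwinnertonDyer-22298):
# THE CENTRAL INVOLUTION OF `Gal(ℚ(W[2], √−1)/ℚ)` AND THE REFLECTION PAIR — `e_n(ℚ(β_j, √−Δ_W)) = e_n(ℚ(β_j, √−1)) + e_n(ℚ(√−Δ_W))`

HONEST FRAMING. WIDTH-5 attached prover seat `bsd-line-att-p3` g35 on line `birth`; `--supports` stmt-BirchSwinnertonDyer-22298 (helper), closes nothing;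
BSD is NOT proved; crux C2, its verdict and every registered stub untouched. THEOREMS ONLY (no `def`, no named fact, no `sorry`).

WHAT. `W(ℚ)[2] = 0`, `Δ_W, −Δ_W ∉ ℚ²`, `i² = −1`, `M = T ⊔ ℚ⟮i⟯` (`T = ℚ(W[2])`), `δ = 4δ₀`, `w = i·δ` (`w² = −Δ_W`).  `Gal(M/ℚ) = Gal(T/ℚ) × Gal(ℚ(i)/ℚ) ≅ S₃ × C₂`;
its centre is `Gal(M/T) = ⟨z⟩` (order `2`, normal since `T/ℚ` is Galois).  With the `S₃`-pair `σ, τ` of `…PointFieldCarrierGalois` (`⟨τ⟩ = Fix ℚ(β_j, i)`),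
`z(i) = −i`, `z(δ) = δ`, `τ(δ) = −δ`, so `τz` fixes `β_j` and `w`: `⟨τz⟩ = Fix ℚ(β_j, w)`, `⟨σ, τz⟩ = Fix ℚ(w)`.  This seat's Literature lemma
`classNumberPExp_reflectionPair_exact` (`IwasawaTheory.SymmetricThreeTowerExactCentral`: the `S₃` relation for both reflection classes) then gives, at every
layer of the cyclotomic `ℤ₂`-tower and with `e_n(ℚ(i)) = 0` (Weber):
  ★★ **`e_n(ℚ(β_j, √−Δ_W)) = e_n(ℚ(β_j, √−1)) + e_n(ℚ(√−Δ_W))`** — the two CM sextics of the `Δ_W > 0` quarter carry the SAME `μ₂`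
  (att-p3 g34 memo §3.3 «σχ-part»; successor (d) made exact), and `λ₂(ℚ(β_j,√−Δ_W)) = λ₂(ℚ(β_j,i)) + λ₂(ℚ(√−Δ_W))` (Ferrero–Kida term) once `μ₂(ℚ(β_j,i)) = 0`.

* §1 flavour-free Galois lemmas (any base `k`): `finrank_mul_natCard_fixingSubgroup_restrict'`, `exists_central_involution_of_subfield` (`T ≤ M` Galois with
  `[M:T] = 2` ⟹ a central involution generating `Fix T`), `le_fixingSubgroup_restrict_of_forall_apply_eq` (a subgroup fixing generators fixes the subfield).
* §2 the carrier: `exists_central_involution_sup_adjoin_I`; §3 ★ `exists_dSix_data_sup_adjoin_I` — `σ, τ, z` with all six subgroup identifications.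
  The class-number identities are the sequel `…PointFieldCarrierReflectionPairExact`.

References: [CaputoNuccio2020] Prop. 3.12, Rem. 3.13; [Washington1997] §13.1; [MilneFT2022] Ch. 3; tree: this seat's `IwasawaTheory.SymmetricThreeTowerExactCentral`,
`…PointFieldCarrierGalois`, `…PointFieldCarrierDSixExact`, att-p3 g34 `…PointFieldCarrierCM` (`delta_not_mem_adjoin_xT_sup_adjoin_I`, `I_not_mem_divisionField_two`).
-/

set_option linter.dupNamespace false
set_option autoImplicit false

noncomputable section

open scoped Classical NumberField IntermediateField

namespace Summit.BirchSwinnertonDyer.BirchSwinnertonDyer.Theorems.AlignedTransportAtTwoPointFieldCarrierReflectionPair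

open NumberField Polynomial WeierstrassCurve IntermediateField Field
  Literature.NumberTheory.EllipticCurves Literature.NumberTheory.EllipticCurves.Greenberg1999
  Literature.NumberTheory.EllipticCurves.DokchitserDokchitser2012
  Literature.NumberTheory.EllipticCurves.ZpExtension Literature.NumberTheory.GaloisRepresentations
  Literature.NumberTheory.IwasawaTheory Literature.NumberTheory.NumberFields
  Summit.BirchSwinnertonDyer.BirchSwinnertonDyer.Theorems.AlignedTransportAtTwoFineRoad.DivisionCubic
  Summit.BirchSwinnertonDyer.BirchSwinnertonDyer.Theorems.AlignedTransportAtTwoFineRoad.TowerImageDelta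
  Summit.BirchSwinnertonDyer.BirchSwinnertonDyer.Theorems.AlignedTransportAtTwoCubicClosureParity
  Summit.BirchSwinnertonDyer.BirchSwinnertonDyer.Theorems.AlignedTransportAtTwoSexticTowerGrowth
  Summit.BirchSwinnertonDyer.BirchSwinnertonDyer.Theorems.AlignedTransportAtTwoSexticNormRelationDescent
  Summit.BirchSwinnertonDyer.BirchSwinnertonDyer.Theorems.AlignedTransportAtTwoSexticNormRelationDescentSignFree
  Summit.BirchSwinnertonDyer.BirchSwinnertonDyer.Theorems.AlignedTransportAtTwoSexticNormRelationDescentSignFreeAdjoinI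
  Summit.BirchSwinnertonDyer.BirchSwinnertonDyer.Theorems.AlignedTransportAtTwoSexticLambdaKuroda
  Summit.BirchSwinnertonDyer.BirchSwinnertonDyer.Theorems.AlignedTransportAtTwoPointFieldCarrierCM
  Summit.BirchSwinnertonDyer.BirchSwinnertonDyer.Theorems.AlignedTransportAtTwoPointFieldCarrierCMIff
  Summit.BirchSwinnertonDyer.BirchSwinnertonDyer.Theorems.AlignedTransportAtTwoResolventMuUnconditional
  Summit.BirchSwinnertonDyer.BirchSwinnertonDyer.Theorems.AlignedTransportAtTwoPointFieldCarrierGalois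
  Summit.BirchSwinnertonDyer.BirchSwinnertonDyer.Theorems.AlignedTransportAtTwoPointFieldCarrierDSixExact

variable (W : WeierstrassCurve ℚ) [W.IsElliptic]

/-! ## §1 Flavour-free Galois lemmas (any base field `k`) -/

/-- `[F : k] · |Fix F_M| = [M : k]` for `F ≤ M` with `M/k` finite Galois (`F_M = F ∩ M` as an intermediate field of `M/k`).
[cite: MilneFT2022, Ch. 3 (fundamental theorem)] -/
theorem finrank_mul_natCard_fixingSubgroup_restrict' {k L : Type} [Field k] [Field L] [Algebra k L] {M F : IntermediateField k L}
    (h : F ≤ M) [FiniteDimensional k ↥M] [IsGalois k ↥M] :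
    Module.finrank k ↥F * Nat.card ↥(IntermediateField.restrict h).fixingSubgroup = Module.finrank k ↥M := by
  rw [IsGalois.card_fixingSubgroup_eq_finrank (IntermediateField.restrict h),
    (IntermediateField.restrict_algEquiv h).toLinearEquiv.finrank_eq]
  exact Module.finrank_mul_finrank k ↥(IntermediateField.restrict h) ↥M

/-- **A central involution from a Galois subfield of index `2`.**  `T ≤ M` intermediate fields of `L/k`, `M/k` and `T/k` Galois, `[M : k] = 2·[T : k]`:
there is `z ∈ Gal(M/k)` with `⟨z⟩ = Fix T_M`, `z² = 1`, `z ≠ 1`, and `z` CENTRAL (a normal subgroup of order `2` is central).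
[cite: MilneFT2022, Ch. 3 (fundamental theorem; normal subgroups ↔ Galois subfields)] -/
theorem exists_central_involution_of_subfield {k L : Type} [Field k] [Field L] [Algebra k L] {M T : IntermediateField k L}
    (hTM : T ≤ M) [FiniteDimensional k ↥M] [IsGalois k ↥M] [FiniteDimensional k ↥T] (hT : IsGalois k ↥T)
    (h2 : Module.finrank k ↥M = 2 * Module.finrank k ↥T) :
    ∃ z : ↥M ≃ₐ[k] ↥M, Subgroup.zpowers z = (IntermediateField.restrict hTM).fixingSubgroup ∧ z ^ 2 = 1 ∧ z ≠ 1 ∧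
      ∀ g : ↥M ≃ₐ[k] ↥M, g * z = z * g := by
  set Z := (IntermediateField.restrict hTM).fixingSubgroup with hZ
  have hZ2 : Nat.card ↥Z = 2 := by
    have h := finrank_mul_natCard_fixingSubgroup_restrict' hTM
    rw [h2] at h
    have hpos : 0 < Module.finrank k ↥T := Module.finrank_pos
    have : Module.finrank k ↥T * Nat.card ↥Z = Module.finrank k ↥T * 2 := by rw [h]; ring
    exact Nat.eq_of_mul_eq_mul_left hpos this
  -- a generator
  obtain ⟨⟨z, hzZ⟩, hz1⟩ := Subgroup.ne_bot_iff_exists_ne_one.mp (Z.one_lt_card_iff_ne_bot.mp (by omega))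
  have hz1' : z ≠ 1 := fun h => hz1 (Subtype.ext (by simpa using h))
  have hord : orderOf z = 2 := by
    have hdvd : orderOf z ∣ 2 := hZ2 ▸ Subgroup.orderOf_dvd_natCard Z hzZ
    rcases (Nat.dvd_prime Nat.prime_two).mp hdvd with h | h
    · exact absurd (orderOf_eq_one_iff.mp h) hz1'
    · exact h
  have hzZ' : Subgroup.zpowers z = Z :=
    Subgroup.eq_of_le_of_card_ge (Subgroup.zpowers_le.mpr hzZ) (by rw [Nat.card_zpowers, hord, hZ2])
  have hz2 : z ^ 2 = 1 := by rw [← hord]; exact pow_orderOf_eq_one z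
  -- normality of `Fix T_M`, hence centrality
  haveI : IsGalois k ↥(IntermediateField.restrict hTM) := IsGalois.of_algEquiv (IntermediateField.restrict_algEquiv hTM)
  haveI hN : Z.Normal := IsGalois.fixingSubgroup_normal_of_isGalois (IntermediateField.restrict hTM)
  refine ⟨z, hzZ', hz2, hz1', fun g ↦ ?_⟩
  have hconj : g * z * g⁻¹ ∈ Z := hN.conj_mem z hzZ g
  rw [← hzZ'] at hconj
  have hfin : IsOfFinOrder z := isOfFinOrder_iff_pow_eq_one.mpr ⟨2, two_pos, hz2⟩
  rw [hfin.mem_zpowers_iff_mem_range_orderOf, hord] at hconj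
  simp only [Finset.mem_image, Finset.mem_range] at hconj
  obtain ⟨m, hm, hmeq⟩ := hconj
  interval_cases m
  · rw [pow_zero] at hmeq
    have : z = 1 := by
      have h1 : g * z * g⁻¹ = 1 := hmeq.symm
      calc z = g⁻¹ * (g * z * g⁻¹) * g := by group
        _ = 1 := by rw [h1]; group
    exact absurd this hz1'
  · rw [pow_one] at hmeq
    calc g * z = g * z * g⁻¹ * g := by group
      _ = z * g := by rw [← hmeq]

/-- **A subgroup fixing generators fixes the subfield**: `F ≤ adjoin k S ⊆ M` with `S ⊆ M`, and every `g ∈ H` fixing every `s ∈ S` (as elements of `M`)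
⟹ `H ≤ Fix F_M`. [cite: MilneFT2022, Ch. 3] -/
theorem le_fixingSubgroup_restrict_of_forall_apply_eq {k L : Type} [Field k] [Field L] [Algebra k L] {M F : IntermediateField k L}
    (h : F ≤ M) (S : Set L) (hSM : S ⊆ M) (hFS : F ≤ IntermediateField.adjoin k S) (H : Subgroup (↥M ≃ₐ[k] ↥M))
    (hfix : ∀ (s : L) (hs : s ∈ S), ∀ g ∈ H, g ⟨s, hSM hs⟩ = ⟨s, hSM hs⟩) :
    H ≤ (IntermediateField.restrict h).fixingSubgroup := by
  intro g hg
  rw [IntermediateField.mem_fixingSubgroup_iff]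
  intro y hy
  have hyF : y.1 ∈ F := (IntermediateField.mem_restrict h y).mp hy
  have hsub : S ⊆ (IntermediateField.lift (IntermediateField.fixedField H) : Set L) := by
    intro s hs
    have : (⟨s, hSM hs⟩ : ↥M) ∈ IntermediateField.fixedField H :=
      (IntermediateField.mem_fixedField_iff H _).mpr (fun f hf ↦ hfix s hs f hf)
    exact (IntermediateField.mem_lift ⟨s, hSM hs⟩).mpr this
  have hle : IntermediateField.adjoin k S ≤ IntermediateField.lift (IntermediateField.fixedField H) := IntermediateField.adjoin_le_iff.mpr hsub
  have hy' : y ∈ IntermediateField.fixedField H := (IntermediateField.mem_lift y).mp (hle (hFS hyF))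
  exact (IntermediateField.mem_fixedField_iff H y).mp hy' g hg

/-! ## §2 The carrier: `T ≤ M`, the central involution -/

omit [W.IsElliptic] in
/-- `ℚ(W[2]) ≤ ℚ(W[2]) ⊔ ℚ⟮i⟯`. -/
theorem divisionField_two_le_sup (i : AlgebraicClosure ℚ) :
    W.divisionField 2 ≤ W.divisionField 2 ⊔ IntermediateField.adjoin ℚ ({i} : Set (AlgebraicClosure ℚ)) :=
  le_sup_left

/-- `ℚ⟮i·δ⟯ ≤ M` (`w = i·δ`, `w² = −Δ_W`). -/
theorem adjoin_w_le_sup (i : AlgebraicClosure ℚ) :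
    ℚ⟮i * (4 * delta W two_ne_zero)⟯ ≤ W.divisionField 2 ⊔ IntermediateField.adjoin ℚ ({i} : Set (AlgebraicClosure ℚ)) :=
  adjoin_simple_le_iff.mpr (mul_mem (adjoin_I_le_sup W i (IntermediateField.mem_adjoin_simple_self ℚ i))
    (le_sup_left (b := IntermediateField.adjoin ℚ ({i} : Set (AlgebraicClosure ℚ))) (delta_mem_and_sq W).1))

/-- `ℚ⟮β_j⟯ ⊔ ℚ⟮i·δ⟯ ≤ M`. -/
theorem adjoin_xT_sup_adjoin_w_le_sup (i : AlgebraicClosure ℚ) (j : Fin 3) :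
    ℚ⟮xT W two_ne_zero j⟯ ⊔ ℚ⟮i * (4 * delta W two_ne_zero)⟯ ≤ W.divisionField 2 ⊔ IntermediateField.adjoin ℚ ({i} : Set (AlgebraicClosure ℚ)) :=
  sup_le ((adjoin_simple_le_iff.mpr (xT_mem W j)).trans le_sup_left) (adjoin_w_le_sup W i)

/-- `[ℚ(i·δ) : ℚ] = 2` (`(iδ)² = −Δ_W ∉ ℚ²`). [cite: SilvermanAEC2009, III.§1] -/
theorem finrank_adjoin_w (hnegΔ : ¬ IsSquare (-W.Δ)) {i : AlgebraicClosure ℚ} (hi : i ^ 2 = -1) :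
    Module.finrank ℚ ↥ℚ⟮i * (4 * delta W two_ne_zero)⟯ = 2 := by
  refine finrank_adjoin_eq_two_of_sq_eq (q := -W.Δ) ?_ hnegΔ
  rw [mul_pow, hi, (delta_mem_and_sq W).2]
  push_cast
  ring

/-- `[ℚ(β_j, i·δ) : ℚ] = 6`. [cite: SilvermanAEC2009, III.§1 and VIII.§1] -/
theorem finrank_adjoin_xT_sup_adjoin_w (ht : ∀ x : ℚ, ¬ HasRationalTwoTorsionX W x) (hnegΔ : ¬ IsSquare (-W.Δ))
    {i : AlgebraicClosure ℚ} (hi : i ^ 2 = -1) (j : Fin 3) :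
    Module.finrank ℚ ↥(ℚ⟮xT W two_ne_zero j⟯ ⊔ ℚ⟮i * (4 * delta W two_ne_zero)⟯) = 6 := by
  set β : AlgebraicClosure ℚ := xT W two_ne_zero j
  set w : AlgebraicClosure ℚ := i * (4 * delta W two_ne_zero)
  have hβint : IsIntegral ℚ β := ((AlgebraicClosure.isAlgebraic ℚ).isAlgebraic β).isIntegral
  have hwint : IsIntegral ℚ w := ((AlgebraicClosure.isAlgebraic ℚ).isAlgebraic w).isIntegral
  haveI : FiniteDimensional ℚ ↥ℚ⟮β⟯ := IntermediateField.adjoin.finiteDimensional hβint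
  haveI : FiniteDimensional ℚ ↥ℚ⟮w⟯ := IntermediateField.adjoin.finiteDimensional hwint
  haveI : FiniteDimensional ℚ ↥(ℚ⟮β⟯ ⊔ ℚ⟮w⟯) := IntermediateField.finiteDimensional_sup ℚ⟮β⟯ ℚ⟮w⟯
  have hF3 : Module.finrank ℚ ↥ℚ⟮β⟯ = 3 := finrank_adjoin_xT_model W ht j
  have hK2 : Module.finrank ℚ ↥ℚ⟮w⟯ = 2 := finrank_adjoin_w W hnegΔ hi
  have hle : Module.finrank ℚ ↥(ℚ⟮β⟯ ⊔ ℚ⟮w⟯) ≤ 6 := by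
    have h := IntermediateField.finrank_sup_le ℚ⟮β⟯ ℚ⟮w⟯
    rw [hF3, hK2] at h
    exact h
  have h3 : 3 ∣ Module.finrank ℚ ↥(ℚ⟮β⟯ ⊔ ℚ⟮w⟯) := hF3 ▸ IntermediateField.finrank_dvd_of_le_right (le_sup_left : ℚ⟮β⟯ ≤ ℚ⟮β⟯ ⊔ ℚ⟮w⟯)
  have h2 : 2 ∣ Module.finrank ℚ ↥(ℚ⟮β⟯ ⊔ ℚ⟮w⟯) := hK2 ▸ IntermediateField.finrank_dvd_of_le_right (le_sup_right : ℚ⟮w⟯ ≤ ℚ⟮β⟯ ⊔ ℚ⟮w⟯)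
  have hpos : 0 < Module.finrank ℚ ↥(ℚ⟮β⟯ ⊔ ℚ⟮w⟯) := Module.finrank_pos
  omega

/-- **The central involution of the carrier.**  `W(ℚ)[2] = 0`, `Δ_W, −Δ_W ∉ ℚ²`, `i² = −1`: there is `z ∈ Gal(M/ℚ)` with `⟨z⟩ = Fix T_M = Gal(M/ℚ(W[2]))`,
`z² = 1`, `z ≠ 1`, `z` central. [cite: MilneFT2022, Ch. 3] -/
theorem exists_central_involution_sup_adjoin_I (ht : ∀ x : ℚ, ¬ HasRationalTwoTorsionX W x) (hsq : ¬ IsSquare W.Δ)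
    (hnegΔ : ¬ IsSquare (-W.Δ)) {i : AlgebraicClosure ℚ} (hi : i ^ 2 = -1) :
    ∃ z : ↥(W.divisionField 2 ⊔ IntermediateField.adjoin ℚ ({i} : Set (AlgebraicClosure ℚ))) ≃ₐ[ℚ]
        ↥(W.divisionField 2 ⊔ IntermediateField.adjoin ℚ ({i} : Set (AlgebraicClosure ℚ))),
      Subgroup.zpowers z = (IntermediateField.restrict (divisionField_two_le_sup W i)).fixingSubgroup ∧ z ^ 2 = 1 ∧ z ≠ 1 ∧
      ∀ g, g * z = z * g :=
  @exists_central_involution_of_subfield ℚ (AlgebraicClosure ℚ) _ _ _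
    (W.divisionField 2 ⊔ IntermediateField.adjoin ℚ ({i} : Set (AlgebraicClosure ℚ))) (W.divisionField 2)
    (divisionField_two_le_sup W i) (finiteDimensional_divisionField_two_sup_adjoin_I W hi) (isGalois_divisionField_two_sup_adjoin_I W hi)
    inferInstance (W.isGalois_divisionField 2)
    (by rw [finrank_divisionField_two_sup_adjoin_I W ht hsq hnegΔ hi, finrank_divisionField_two_eq_six W ht hsq])


/-! ## §3 The `D₆` data of the carrier: `σ, τ, z` and the six fixing subgroups -/

/-- Powers of an automorphism fixing `x` fix `x`. [folklore] -/
private theorem forall_mem_zpowers_apply_eq {K E : Type} [Field K] [Field E] [Algebra K E] {g : E ≃ₐ[K] E} {x : E} (hgx : g x = x) :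
    ∀ f ∈ Subgroup.zpowers g, f x = x := by
  have hstab : Subgroup.zpowers g ≤ MulAction.stabilizer (E ≃ₐ[K] E) x :=
    Subgroup.zpowers_le.mpr (by rw [MulAction.mem_stabilizer_iff, AlgEquiv.smul_def]; exact hgx)
  intro f hf
  have h := hstab hf
  rw [MulAction.mem_stabilizer_iff, AlgEquiv.smul_def] at h
  exact h

/-- Elements of the subgroup generated by two automorphisms fixing `x` fix `x`. [folklore] -/
private theorem forall_mem_closure_pair_apply_eq {K E : Type} [Field K] [Field E] [Algebra K E] {g g' : E ≃ₐ[K] E} {x : E}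
    (hgx : g x = x) (hg'x : g' x = x) : ∀ f ∈ Subgroup.closure ({g, g'} : Set (E ≃ₐ[K] E)), f x = x := by
  have hstab : Subgroup.closure ({g, g'} : Set (E ≃ₐ[K] E)) ≤ MulAction.stabilizer (E ≃ₐ[K] E) x := by
    rw [Subgroup.closure_le]
    intro f hf
    rcases hf with hf | hf
    · rw [hf]; simpa [MulAction.mem_stabilizer_iff, AlgEquiv.smul_def] using hgx
    · rw [Set.mem_singleton_iff.mp hf]; simpa [MulAction.mem_stabilizer_iff, AlgEquiv.smul_def] using hg'x
  intro f hf
  have h := hstab hf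
  rw [MulAction.mem_stabilizer_iff, AlgEquiv.smul_def] at h
  exact h

set_option maxHeartbeats 800000 in
/-- ★ **The `D₆` data of the PFμ⁺ carrier.**  `W(ℚ)[2] = 0`, `Δ_W, −Δ_W ∉ ℚ²`, `i² = −1`, `M = ℚ(W[2]) ⊔ ℚ⟮i⟯`, `w = i·δ`, `j : Fin 3`: there are
`σ, τ, z ∈ Gal(M/ℚ)` with `⟨σ⟩ = Fix ℚ(i,δ)_M`, `⟨τ⟩ = Fix ℚ(β_j,i)_M`, `σ³ = 1`, `τ² = 1`, `τσ = σ²τ`, `⟨σ,τ⟩ = Fix ℚ(i)_M`, `z² = 1`, `zσ = σz`, `zτ = τz`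
(`⟨z⟩ = Gal(M/ℚ(W[2]))` central), and for the second reflection `τz`: **`⟨τz⟩ = Fix ℚ(β_j, w)_M`** and **`⟨σ, τz⟩ = Fix ℚ(w)_M`** (`z(i) = −i` since
`i ∉ ℚ(W[2])`, `τ(δ) = −δ` since `δ ∉ ℚ(β_j, i)`, so `τz` fixes `β_j` and `w = iδ`; orders `2 = 12/6` and `6 = 12/2`). [cite: MilneFT2022, Ch. 3]
[cite: CaputoNuccio2020, §2 (the dihedral group and its reflections)] -/
theorem exists_dSix_data_sup_adjoin_I (ht : ∀ x : ℚ, ¬ HasRationalTwoTorsionX W x) (hsq : ¬ IsSquare W.Δ)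
    (hnegΔ : ¬ IsSquare (-W.Δ)) {i : AlgebraicClosure ℚ} (hi : i ^ 2 = -1) (j : Fin 3) :
    ∃ σ τ z : ↥(W.divisionField 2 ⊔ IntermediateField.adjoin ℚ ({i} : Set (AlgebraicClosure ℚ))) ≃ₐ[ℚ] ↥(W.divisionField 2 ⊔ IntermediateField.adjoin ℚ ({i} : Set (AlgebraicClosure ℚ))),
      Subgroup.zpowers σ = (IntermediateField.restrict (adjoin_I_sup_adjoin_delta_le_sup W i)).fixingSubgroup ∧
      Subgroup.zpowers τ = (IntermediateField.restrict (adjoin_xT_sup_adjoin_I_le_sup W i j)).fixingSubgroup ∧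
      σ ^ 3 = 1 ∧ τ ^ 2 = 1 ∧ τ * σ = σ ^ 2 * τ ∧
      Subgroup.closure {σ, τ} = (IntermediateField.restrict (adjoin_I_le_sup W i)).fixingSubgroup ∧
      z ^ 2 = 1 ∧ z * σ = σ * z ∧ z * τ = τ * z ∧
      Subgroup.zpowers (τ * z) = (IntermediateField.restrict (adjoin_xT_sup_adjoin_w_le_sup W i j)).fixingSubgroup ∧
      Subgroup.closure {σ, τ * z} = (IntermediateField.restrict (adjoin_w_le_sup W i)).fixingSubgroup := by
  haveI hfd : FiniteDimensional ℚ ↥(W.divisionField 2 ⊔ IntermediateField.adjoin ℚ ({i} : Set (AlgebraicClosure ℚ))) := finiteDimensional_divisionField_two_sup_adjoin_I W hi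
  haveI hgal : IsGalois ℚ ↥(W.divisionField 2 ⊔ IntermediateField.adjoin ℚ ({i} : Set (AlgebraicClosure ℚ))) := isGalois_divisionField_two_sup_adjoin_I W hi
  obtain ⟨σ, τ, hσN, hτH, hσ3, hτ2, hrel, hgen⟩ := exists_symmetricThree_pair_sup_adjoin_I W ht hsq hnegΔ hi j
  obtain ⟨z, hzZ, hz2, hz1, hcen⟩ := exists_central_involution_sup_adjoin_I W ht hsq hnegΔ hi
  have h12 : Module.finrank ℚ ↥(W.divisionField 2 ⊔ IntermediateField.adjoin ℚ ({i} : Set (AlgebraicClosure ℚ))) = 12 := finrank_divisionField_two_sup_adjoin_I W ht hsq hnegΔ hi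
  set δ : AlgebraicClosure ℚ := 4 * delta W two_ne_zero with hδdef
  set β : AlgebraicClosure ℚ := xT W two_ne_zero j with hβdef
  have hiM : i ∈ (W.divisionField 2 ⊔ IntermediateField.adjoin ℚ ({i} : Set (AlgebraicClosure ℚ))) := adjoin_I_le_sup W i (IntermediateField.mem_adjoin_simple_self ℚ i)
  have hδM : δ ∈ (W.divisionField 2 ⊔ IntermediateField.adjoin ℚ ({i} : Set (AlgebraicClosure ℚ))) := divisionField_two_le_sup W i (delta_mem_and_sq W).1
  have hβM : β ∈ (W.divisionField 2 ⊔ IntermediateField.adjoin ℚ ({i} : Set (AlgebraicClosure ℚ))) := divisionField_two_le_sup W i (xT_mem W j)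
  set iM : ↥(W.divisionField 2 ⊔ IntermediateField.adjoin ℚ ({i} : Set (AlgebraicClosure ℚ))) := ⟨i, hiM⟩ with hiMdef
  set δM : ↥(W.divisionField 2 ⊔ IntermediateField.adjoin ℚ ({i} : Set (AlgebraicClosure ℚ))) := ⟨δ, hδM⟩ with hδMdef
  set βM : ↥(W.divisionField 2 ⊔ IntermediateField.adjoin ℚ ({i} : Set (AlgebraicClosure ℚ))) := ⟨β, hβM⟩ with hβMdef
  have fixes : ∀ {F : IntermediateField ℚ (AlgebraicClosure ℚ)} (hF : F ≤ (W.divisionField 2 ⊔ IntermediateField.adjoin ℚ ({i} : Set (AlgebraicClosure ℚ)))) {g : ↥(W.divisionField 2 ⊔ IntermediateField.adjoin ℚ ({i} : Set (AlgebraicClosure ℚ))) ≃ₐ[ℚ] ↥(W.divisionField 2 ⊔ IntermediateField.adjoin ℚ ({i} : Set (AlgebraicClosure ℚ)))},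
      g ∈ (IntermediateField.restrict hF).fixingSubgroup → ∀ x : ↥(W.divisionField 2 ⊔ IntermediateField.adjoin ℚ ({i} : Set (AlgebraicClosure ℚ))), x.1 ∈ F → g x = x := by
    intro F hF g hg x hx
    exact (IntermediateField.mem_fixingSubgroup_iff _ _).mp hg x ((IntermediateField.mem_restrict hF x).mpr hx)
  have hτmem : τ ∈ (IntermediateField.restrict (adjoin_xT_sup_adjoin_I_le_sup W i j)).fixingSubgroup := hτH ▸ Subgroup.mem_zpowers τ
  have hσmem : σ ∈ (IntermediateField.restrict (adjoin_I_sup_adjoin_delta_le_sup W i)).fixingSubgroup := hσN ▸ Subgroup.mem_zpowers σ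
  have hzmem : z ∈ (IntermediateField.restrict (divisionField_two_le_sup W i)).fixingSubgroup := hzZ ▸ Subgroup.mem_zpowers z
  have hiQ : i ∈ IntermediateField.adjoin ℚ ({i} : Set (AlgebraicClosure ℚ)) := IntermediateField.mem_adjoin_simple_self ℚ i
  have hτi : τ iM = iM := fixes _ hτmem iM ((le_sup_right : _ ≤ ℚ⟮β⟯ ⊔ _) hiQ)
  have hτβ : τ βM = βM := fixes _ hτmem βM ((le_sup_left : ℚ⟮β⟯ ≤ ℚ⟮β⟯ ⊔ _) (IntermediateField.mem_adjoin_simple_self ℚ β))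
  have hσi : σ iM = iM := fixes _ hσmem iM ((le_sup_left : _ ≤ _ ⊔ ℚ⟮δ⟯) hiQ)
  have hσδ : σ δM = δM := fixes _ hσmem δM ((le_sup_right : ℚ⟮δ⟯ ≤ _ ⊔ ℚ⟮δ⟯) (IntermediateField.mem_adjoin_simple_self ℚ δ))
  have hzδ : z δM = δM := fixes _ hzmem δM (delta_mem_and_sq W).1
  have hzβ : z βM = βM := fixes _ hzmem βM (xT_mem W j)
  -- `z(i) = −i`: otherwise `i` lies in the fixed field of `z`, which is `T`
  have hiM2 : iM ^ 2 = -1 := Subtype.ext (show i ^ 2 = -1 from hi)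
  have eZ : IntermediateField.fixedField (Subgroup.zpowers z) = IntermediateField.restrict (divisionField_two_le_sup W i) := by
    rw [hzZ]
    exact @IsGalois.fixedField_fixingSubgroup ℚ _ ↥(W.divisionField 2 ⊔ IntermediateField.adjoin ℚ ({i} : Set (AlgebraicClosure ℚ))) _ _ _ hfd hgal
  have eP : IntermediateField.fixedField (Subgroup.zpowers τ) = IntermediateField.restrict (adjoin_xT_sup_adjoin_I_le_sup W i j) := by
    rw [hτH]
    exact @IsGalois.fixedField_fixingSubgroup ℚ _ ↥(W.divisionField 2 ⊔ IntermediateField.adjoin ℚ ({i} : Set (AlgebraicClosure ℚ))) _ _ _ hfd hgal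
  have hzi : z iM = -iM := by
    have hsq2 : (z iM) ^ 2 = iM ^ 2 := by rw [← map_pow, hiM2, map_neg, map_one]
    rcases eq_or_eq_neg_of_sq_eq_sq _ _ hsq2 with h | h
    · exfalso
      have hfix : iM ∈ IntermediateField.fixedField (Subgroup.zpowers z) :=
        (IntermediateField.mem_fixedField_iff _ _).mpr (forall_mem_zpowers_apply_eq h)
      have hfix2 : iM ∈ IntermediateField.restrict (divisionField_two_le_sup W i) := by rw [← eZ]; exact hfix
      exact I_not_mem_divisionField_two W ht hsq hnegΔ hi ((IntermediateField.mem_restrict _ iM).mp hfix2)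
    · exact h
  -- `τ(δ) = −δ`: otherwise `δ` lies in the fixed field of `τ`, which is `ℚ(β_j, i)`
  have hδM2 : δM ^ 2 = algebraMap ℚ ↥(W.divisionField 2 ⊔ IntermediateField.adjoin ℚ ({i} : Set (AlgebraicClosure ℚ))) W.Δ :=
    Subtype.ext (show δ ^ 2 = ((algebraMap ℚ ↥(W.divisionField 2 ⊔ IntermediateField.adjoin ℚ ({i} : Set (AlgebraicClosure ℚ))) W.Δ : ↥(W.divisionField 2 ⊔ IntermediateField.adjoin ℚ ({i} : Set (AlgebraicClosure ℚ)))) : AlgebraicClosure ℚ) by rw [(delta_mem_and_sq W).2]; rfl)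
  have hτδ : τ δM = -δM := by
    have hsq2 : (τ δM) ^ 2 = δM ^ 2 := by rw [← map_pow, hδM2, AlgEquiv.commutes]
    rcases eq_or_eq_neg_of_sq_eq_sq _ _ hsq2 with h | h
    · exfalso
      have hfix : δM ∈ IntermediateField.fixedField (Subgroup.zpowers τ) :=
        (IntermediateField.mem_fixedField_iff _ _).mpr (forall_mem_zpowers_apply_eq h)
      have hfix2 : δM ∈ IntermediateField.restrict (adjoin_xT_sup_adjoin_I_le_sup W i j) := by rw [← eP]; exact hfix
      exact delta_not_mem_adjoin_xT_sup_adjoin_I W ht hsq hnegΔ hi j ((IntermediateField.mem_restrict _ δM).mp hfix2)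
    · exact h
  -- the second reflection `τz` fixes `β_j` and `w = iδ`; `σ` fixes `w`
  have hτz_w : (τ * z) (iM * δM) = iM * δM := by
    rw [AlgEquiv.mul_apply, map_mul, hzi, hzδ, map_mul, map_neg, hτi, hτδ]
    ring
  have hτz_β : (τ * z) βM = βM := by rw [AlgEquiv.mul_apply, hzβ, hτβ]
  have hσ_w : σ (iM * δM) = iM * δM := by rw [map_mul, hσi, hσδ]
  have hzσ : z * σ = σ * z := (hcen σ).symm
  have hzτ : z * τ = τ * z := (hcen τ).symm
  have hτz2 : (τ * z) ^ 2 = 1 := by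
    calc (τ * z) ^ 2 = τ * (z * τ) * z := by rw [sq]; group
      _ = τ * (τ * z) * z := by rw [hzτ]
      _ = τ ^ 2 * z ^ 2 := by rw [sq, sq]; group
      _ = 1 := by rw [hτ2, hz2, one_mul]
  have hτz1 : τ * z ≠ 1 := by
    intro h1
    have hτ_eq : τ = z := by
      have hzinv : z⁻¹ = z := by
        rw [inv_eq_iff_mul_eq_one, ← sq, hz2]
      calc τ = τ * z * z⁻¹ := by group
        _ = z := by rw [h1, one_mul, hzinv]
    have heq : iM = -iM := by
      calc iM = τ iM := hτi.symm
        _ = z iM := by rw [hτ_eq]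
        _ = -iM := hzi
    have hval : i = -i := by simpa using congrArg Subtype.val heq
    have h2 : (2 : AlgebraicClosure ℚ) * i = 0 := by linear_combination hval
    rcases mul_eq_zero.mp h2 with h | h
    · norm_num at h
    · rw [h] at hi
      norm_num at hi
  have hord : orderOf (τ * z) = 2 := orderOf_eq_prime hτz2 hτz1
  -- `⟨τz⟩ = Fix ℚ(β_j, w)_M`
  have hwM : i * δ ∈ (W.divisionField 2 ⊔ IntermediateField.adjoin ℚ ({i} : Set (AlgebraicClosure ℚ))) := mul_mem hiM hδM
  have hP2le : Subgroup.zpowers (τ * z) ≤ (IntermediateField.restrict (adjoin_xT_sup_adjoin_w_le_sup W i j)).fixingSubgroup := by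
    refine le_fixingSubgroup_restrict_of_forall_apply_eq (adjoin_xT_sup_adjoin_w_le_sup W i j) ({β} ∪ {i * δ}) ?_ ?_ _ ?_
    · rintro s (hs | hs)
      · rw [Set.mem_singleton_iff.mp hs]; exact hβM
      · rw [Set.mem_singleton_iff.mp hs]; exact hwM
    · rw [IntermediateField.adjoin_union]
    · rintro s (hs | hs) g hg
      · have hs' := Set.mem_singleton_iff.mp hs
        subst hs'
        exact forall_mem_zpowers_apply_eq hτz_β g hg
      · have hs' := Set.mem_singleton_iff.mp hs
        subst hs'
        exact forall_mem_zpowers_apply_eq hτz_w g hg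
  have hcP2 : Nat.card ↥(IntermediateField.restrict (adjoin_xT_sup_adjoin_w_le_sup W i j)).fixingSubgroup = 2 := by
    have h := (@finrank_mul_natCard_fixingSubgroup_restrict' ℚ (AlgebraicClosure ℚ) _ _ _ _ _ (adjoin_xT_sup_adjoin_w_le_sup W i j) hfd hgal).trans h12
    rw [finrank_adjoin_xT_sup_adjoin_w W ht hnegΔ hi j] at h
    omega
  have hP2 : Subgroup.zpowers (τ * z) = (IntermediateField.restrict (adjoin_xT_sup_adjoin_w_le_sup W i j)).fixingSubgroup :=
    Subgroup.eq_of_le_of_card_ge hP2le (hcP2.trans_le (by rw [Nat.card_zpowers, hord]))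
  -- `⟨σ, τz⟩ = Fix ℚ(w)_M`
  have hQ2le : Subgroup.closure {σ, τ * z} ≤ (IntermediateField.restrict (adjoin_w_le_sup W i)).fixingSubgroup := by
    refine le_fixingSubgroup_restrict_of_forall_apply_eq (adjoin_w_le_sup W i) {i * δ} ?_ le_rfl _ ?_
    · intro s hs; rw [Set.mem_singleton_iff.mp hs]; exact hwM
    · intro s hs g hg
      have hs' := Set.mem_singleton_iff.mp hs
      subst hs'
      exact forall_mem_closure_pair_apply_eq hσ_w hτz_w g hg
  have hcQ2 : Nat.card ↥(IntermediateField.restrict (adjoin_w_le_sup W i)).fixingSubgroup = 6 := by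
    have h := (@finrank_mul_natCard_fixingSubgroup_restrict' ℚ (AlgebraicClosure ℚ) _ _ _ _ _ (adjoin_w_le_sup W i) hfd hgal).trans h12
    rw [finrank_adjoin_w W hnegΔ hi] at h
    omega
  have hcN : Nat.card ↥(Subgroup.zpowers σ) = 3 := by
    have h := (@finrank_mul_natCard_fixingSubgroup_restrict' ℚ (AlgebraicClosure ℚ) _ _ _ _ _ (adjoin_I_sup_adjoin_delta_le_sup W i) hfd hgal).trans h12
    rw [finrank_adjoin_I_sup_adjoin_delta W ht hsq hnegΔ hi] at h
    have h3 : Nat.card ↥(IntermediateField.restrict (adjoin_I_sup_adjoin_delta_le_sup W i)).fixingSubgroup = 3 := by omega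
    exact (congrArg (fun H : Subgroup _ ↦ Nat.card ↥H) hσN).trans h3
  have hσle : Subgroup.zpowers σ ≤ Subgroup.closure {σ, τ * z} :=
    Subgroup.zpowers_le.mpr (Subgroup.subset_closure (Set.mem_insert σ _))
  have hτzmem : τ * z ∈ Subgroup.closure ({σ, τ * z} : Set (↥(W.divisionField 2 ⊔ IntermediateField.adjoin ℚ ({i} : Set (AlgebraicClosure ℚ))) ≃ₐ[ℚ] ↥(W.divisionField 2 ⊔ IntermediateField.adjoin ℚ ({i} : Set (AlgebraicClosure ℚ))))) :=
    Subgroup.subset_closure (Set.mem_insert_of_mem σ (Set.mem_singleton _))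
  haveI : Finite ↥(IntermediateField.restrict (adjoin_w_le_sup W i)).fixingSubgroup := Nat.finite_of_card_ne_zero (by rw [hcQ2]; norm_num)
  have hcC : Nat.card ↥(Subgroup.closure ({σ, τ * z} : Set (↥(W.divisionField 2 ⊔ IntermediateField.adjoin ℚ ({i} : Set (AlgebraicClosure ℚ))) ≃ₐ[ℚ] ↥(W.divisionField 2 ⊔ IntermediateField.adjoin ℚ ({i} : Set (AlgebraicClosure ℚ)))))) = 6 := by
    have hdvd6 : Nat.card ↥(Subgroup.closure ({σ, τ * z} : Set (↥(W.divisionField 2 ⊔ IntermediateField.adjoin ℚ ({i} : Set (AlgebraicClosure ℚ))) ≃ₐ[ℚ] ↥(W.divisionField 2 ⊔ IntermediateField.adjoin ℚ ({i} : Set (AlgebraicClosure ℚ)))))) ∣ 6 :=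
      (Subgroup.card_dvd_of_le hQ2le).trans (dvd_of_eq hcQ2)
    have hdvd3 : 3 ∣ Nat.card ↥(Subgroup.closure ({σ, τ * z} : Set (↥(W.divisionField 2 ⊔ IntermediateField.adjoin ℚ ({i} : Set (AlgebraicClosure ℚ))) ≃ₐ[ℚ] ↥(W.divisionField 2 ⊔ IntermediateField.adjoin ℚ ({i} : Set (AlgebraicClosure ℚ)))))) :=
      (dvd_of_eq hcN.symm).trans (Subgroup.card_dvd_of_le hσle)
    have hne3 : Nat.card ↥(Subgroup.closure ({σ, τ * z} : Set (↥(W.divisionField 2 ⊔ IntermediateField.adjoin ℚ ({i} : Set (AlgebraicClosure ℚ))) ≃ₐ[ℚ] ↥(W.divisionField 2 ⊔ IntermediateField.adjoin ℚ ({i} : Set (AlgebraicClosure ℚ)))))) ≠ 3 := by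
      intro h3
      haveI : Finite ↥(Subgroup.closure ({σ, τ * z} : Set (↥(W.divisionField 2 ⊔ IntermediateField.adjoin ℚ ({i} : Set (AlgebraicClosure ℚ))) ≃ₐ[ℚ] ↥(W.divisionField 2 ⊔ IntermediateField.adjoin ℚ ({i} : Set (AlgebraicClosure ℚ)))))) := Nat.finite_of_card_ne_zero (by rw [h3]; norm_num)
      have heq : Subgroup.zpowers σ = Subgroup.closure {σ, τ * z} := Subgroup.eq_of_le_of_card_ge hσle (h3.trans hcN.symm).le
      have hmem : τ * z ∈ Subgroup.zpowers σ := heq ▸ hτzmem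
      have hdvd : orderOf (τ * z) ∣ Nat.card ↥(Subgroup.zpowers σ) := Subgroup.orderOf_dvd_natCard _ hmem
      rw [hord, hcN] at hdvd
      omega
    obtain ⟨c, hc⟩ := hdvd3
    have hc' : 3 * c ∣ 6 := hc ▸ hdvd6
    have hcle : c ≤ 2 := by
      have := Nat.le_of_dvd (by norm_num) hc'
      omega
    interval_cases c <;> omega
  have hQ2 : Subgroup.closure {σ, τ * z} = (IntermediateField.restrict (adjoin_w_le_sup W i)).fixingSubgroup :=
    Subgroup.eq_of_le_of_card_ge hQ2le (hcQ2.trans hcC.symm).le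
  exact ⟨σ, τ, z, hσN, hτH, hσ3, hτ2, hrel, hgen, hz2, hzσ, hzτ, hP2, hQ2⟩

end Summit.BirchSwinnertonDyer.BirchSwinnertonDyer.Theorems.AlignedTransportAtTwoPointFieldCarrierReflectionPair

end
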